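import Summits.MatrixMultiplication.OmegaCensus.PhaseArcClassBox

/-!
# ω-census, family (b3): conjecture C9 on the Frobenius family — Layer 5b: a passed CLASS CHECK makes `ℤ/p ⋊_u ℤ/3` not box-useful

HONEST FRAMING (pub-omega census; verbatim): lottery ticket; floor = certified bounds/negative ranges.
Census BOOKKEEPING (conjecture C9 of the cell; pub-omega stpp-1 gen 21).  The generic theorem of Layer 5
(`PhaseArcClassBox.lean` for the vocabulary).  INPUT: a prime `p ≥ 7`, `u` with `u² + u + 1 = 0`, `α ≠ 0` in `ZMod p`,
integers `a_k, e_k` (`k ∈ ZMod 3`) with `8·(u^k α).val = a_k p + e_k` (phases and errors), `Σ e_k = 0`, `|e_k| ≤ ε`, class data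
`cd` passing `cd.ClassOK γ` for the residues `γ_k = a_k mod 8`, and the three linear size conditions
`120ε ≤ 8p − 1200`, `145ε ≤ 13p − 1275`, `6ε < p` (i.e. `72p ≤ 5·MIS·(p − 15) − 5·Σt·ε` on both envelopes, `2·3·ε < p`).  OUTPUT (`not_boxUseful_of_classOK`): `¬ BoxUseful (MetaCyc p 3 u)`.
PROOF: `β := (m + n u)α`; its phases `b_k` and errors `f_k = m e_k + n e_{k+1}` satisfy `8·(u^k β).val = b_k p + f_k` and
`b_k ≡ m a_k + n a_{k+1} (mod 8)` (`p` odd); for the dihedral-type box `dbox α β t` the phase shift of a column pair is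
`Φ = lin t a b ≡ Φ̄(γ) (mod 8)` (`map_lin`) and the error is `E = lin t e f` with `|E| ≤ Sred·ε` (`abs_E_le`), so the residue
conditions of the class check give `PairOK` for every pair with trims `clo·ε`, `chi·ε`; `patIndep_phaseCells` + `arcSet` give an
independent pattern, `card_arcSet_ge` (from `card_arcSet`, `eight_mul_arcLen_ge`) gives `8·#cells ≥ MIS·(p − 15) − Σt·ε`, and
the envelope makes `9p ≤ 5·#cells`; the box is nondegenerate because `α ≠ 0`, `t ≠ 0` and `m + n u ≠ 0` (its norm
`m² − mn + n² ∈ (0, 4]` is not divisible by `p`).  Then `ABox.not_boxUseful_of_pattern`.  Nothing here is progress on `ω`.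
-/

namespace Summit.MatrixMultiplication.OmegaCensus

open Finset

namespace PhaseArcs

variable {p : ℕ}

/-- `8 ∣ p·X` with `p` odd forces `8 ∣ X` (as `p² ≡ 1 (mod 8)`). [folklore] -/
theorem dvd8_of_odd_mul {q X : ℤ} (hq : Odd q) (h : (8 : ℤ) ∣ q * X) : (8 : ℤ) ∣ X := by
  obtain ⟨r, hr⟩ := hq
  have h2 : (8 : ℤ) ∣ q * q - 1 := by
    obtain ⟨s, hs⟩ := Int.even_mul_succ_self r
    refine ⟨s, ?_⟩
    rw [hr]
    linear_combination (4 : ℤ) * hs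
  have : X = q * (q * X) - (q * q - 1) * X := by ring
  rw [this]
  exact dvd_sub (dvd_mul_of_dvd_right h _) (dvd_mul_of_dvd_left h2 _)

/-- **The count.** `MIS·(p − 15) − Σt·ε ≤ 8·#arcSet` for trims `clo·ε`, `chi·ε`. [folklore] -/
theorem card_arcSet_ge [NeZero p] (cd : ClassData) (ε : ℤ) (hε : 0 ≤ ε) (hP : ∀ c, ∀ φ ∈ cd.P c, 0 ≤ φ ∧ φ < 8) :
    (cd.MIS : ℤ) * (p - 15) - cd.SigT * ε ≤
      8 * #(arcSet p cd.P (fun c φ => (cd.clo c φ : ℤ) * ε) (fun c φ => (cd.chi c φ : ℤ) * ε)) := by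
  set lo : Fin 3 × Fin 3 → ℤ → ℤ := fun c φ => (cd.clo c φ : ℤ) * ε with hlo_def
  set hi : Fin 3 × Fin 3 → ℤ → ℤ := fun c φ => (cd.chi c φ : ℤ) * ε with hhi_def
  have hlo : ∀ c, ∀ φ ∈ cd.P c, 0 ≤ lo c φ := fun c φ _ => mul_nonneg (Nat.cast_nonneg _) hε
  have hhi : ∀ c, ∀ φ ∈ cd.P c, 0 ≤ hi c φ := fun c φ _ => mul_nonneg (Nat.cast_nonneg _) hε
  rw [card_arcSet hP hlo hhi]
  simp only [ClassData.MIS, ClassData.SigT]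
  push_cast
  rw [Finset.sum_mul, Finset.sum_mul, ← Finset.sum_sub_distrib, Finset.mul_sum]
  refine Finset.sum_le_sum fun c _ => ?_
  have hconst : (#(cd.P c) : ℤ) * (p - 15) = ∑ φ ∈ cd.P c, ((p : ℤ) - 15) := by
    rw [Finset.sum_const, nsmul_eq_mul]
  rw [hconst, Finset.sum_mul, Finset.mul_sum, ← Finset.sum_sub_distrib]
  refine Finset.sum_le_sum fun φ _ => ?_
  have h1 := eight_mul_arcLen_ge (p := p) (lo := lo) (hi := hi) c φ
  have h2 : arcStop p hi c φ + 1 - arcStart p lo c φ ≤ ((arcStop p hi c φ + 1 - arcStart p lo c φ).toNat : ℤ) :=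
    Int.self_le_toNat _
  simp only [hlo_def, hhi_def] at h1
  linarith

/-- **Layer 5 (generic theorem).** A passed class check, with the three linear size conditions, makes `ℤ/p ⋊_u ℤ/3` not
box-useful.  See the module docstring. [folklore] -/
theorem not_boxUseful_of_classOK [Fact p.Prime] (u : ZMod p) [Fact (u ^ 3 = 1)] (hu : u ^ 2 + u + 1 = 0) (hp7 : 7 ≤ p)
    (α : ZMod p) (hα : α ≠ 0) (a e : ZMod 3 → ℤ) (ha : ∀ k, 8 * ((MetaCyc.act u k * α).val : ℤ) = a k * p + e k)
    (hsum : ∑ k, e k = 0) (ε : ℤ) (hε : ∀ k, |e k| ≤ ε) (cd : ClassData) (hok : cd.ClassOK fun k => (a k : ZMod 8))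
    (hsize : 120 * ε ≤ 8 * (p : ℤ) - 1200 ∧ 145 * ε ≤ 13 * (p : ℤ) - 1275 ∧ 6 * ε < (p : ℤ)) :
    ¬ BoxUseful (MetaCyc p 3 u) := by
  haveI : NeZero p := ⟨(Fact.out : p.Prime).ne_zero⟩
  obtain ⟨h16, h17, hE⟩ := hsize
  obtain ⟨m, n, t, P, clo, chi⟩ := cd
  obtain ⟨hN0, hN4, ht, hP, hS, hpair, henv⟩ := hok
  dsimp only at hN0 hN4 ht hP hS hpair henv
  have hu3 : u ^ 3 = 1 := Fact.out
  have hp0 : (0 : ℤ) < p := by exact_mod_cast (show 0 < p by omega)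
  have hpodd : Odd (p : ℤ) := by
    have h2 : ¬ 2 ∣ p := fun h => by
      have := (Fact.out : p.Prime).eq_one_or_self_of_dvd 2 h
      omega
    rcases Nat.even_or_odd p with h | h
    · exact absurd h.two_dvd h2
    · exact_mod_cast h
  have hε0 : 0 ≤ ε := (abs_nonneg _).trans (hε 0)
  -- `β = (m + n u) α`, its errors `f` and phases `b`
  set β : ZMod p := ((m : ZMod p) + (n : ZMod p) * u) * α with hβdef
  set f : ZMod 3 → ℤ := fun s => m * e s + n * e (s + 1) with hfdef
  have hact1 : ∀ k : ZMod 3, MetaCyc.act u (k + 1) = MetaCyc.act u k * u := by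
    intro k
    rw [MetaCyc.act_add hu3, MetaCyc.act, MetaCyc.act, ZMod.val_one, pow_one]
  have hacast : ∀ k, (8 : ZMod p) * (MetaCyc.act u k * α) = (e k : ZMod p) := by
    intro k
    have h := congrArg (fun z : ℤ => (z : ZMod p)) (ha k)
    push_cast at h
    simpa only [ZMod.natCast_val, ZMod.cast_id', id_eq, ZMod.natCast_self, mul_zero, zero_add] using h
  have hβcast : ∀ k, (8 : ZMod p) * (MetaCyc.act u k * β) = (f k : ZMod p) := by
    intro k
    simp only [hfdef, hβdef]
    push_cast
    rw [← hacast k, ← hacast (k + 1), hact1 k]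
    ring
  have hbdvd : ∀ k, (p : ℤ) ∣ 8 * ((MetaCyc.act u k * β).val : ℤ) - f k := by
    intro k
    rw [← ZMod.intCast_zmod_eq_zero_iff_dvd]
    push_cast
    rw [ZMod.natCast_val, ZMod.cast_id', id_eq, hβcast k, sub_self]
  set b : ZMod 3 → ℤ := fun k => (8 * ((MetaCyc.act u k * β).val : ℤ) - f k) / p with hbdef
  have hb : ∀ k, 8 * ((MetaCyc.act u k * β).val : ℤ) = b k * p + f k := by
    intro k
    simp only [hbdef]
    rw [Int.ediv_mul_cancel (hbdvd k)]
    ring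
  -- residues of `b` mod 8
  have hγb : ∀ k, ((b k : ℤ) : ZMod 8) = (m : ZMod 8) * (a k : ZMod 8) + (n : ZMod 8) * (a (k + 1) : ZMod 8) := by
    intro k
    have hX : (8 : ℤ) ∣ b k - (m * a k + n * a (k + 1)) := by
      apply dvd8_of_odd_mul hpodd
      refine ⟨((MetaCyc.act u k * β).val : ℤ) - m * (MetaCyc.act u k * α).val - n * (MetaCyc.act u (k + 1) * α).val, ?_⟩
      have e1 := hb k
      have e2 := ha k
      have e3 := ha (k + 1)
      simp only [hfdef] at e1
      linear_combination (-1 : ℤ) * e1 + m * e2 + n * e3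
    have h8 := (ZMod.intCast_zmod_eq_zero_iff_dvd _ 8).2 hX
    push_cast at h8
    linear_combination h8
  -- the box and its phase/error data
  set D : MetaCyc.ABox p 3 := dbox α β t with hD
  have hαD : ∀ s i, 8 * ((MetaCyc.act u s * D.α i).val : ℤ) = col a s i * p + col e s i := by
    intro s i
    fin_cases i
    · simp [hD, dbox, col]
    · simpa [hD, dbox, col] using ha s
    · simp [hD, dbox, col]
  have hβD : ∀ s j, 8 * ((MetaCyc.act u s * D.β j).val : ℤ) = col b s j * p + col f s j := by
    intro s j
    fin_cases j
    · simp [hD, dbox, col]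
    · simpa [hD, dbox, col] using hb s
    · simp [hD, dbox, col]
  set lo : Fin 3 × Fin 3 → ℤ → ℤ := fun c φ => (clo c φ : ℤ) * ε with hlo_def
  set hi : Fin 3 × Fin 3 → ℤ → ℤ := fun c φ => (chi c φ : ℤ) * ε with hhi_def
  have hlo : ∀ c, ∀ φ ∈ P c, 0 ≤ lo c φ := fun c φ _ => mul_nonneg (Nat.cast_nonneg _) hε0
  have hhi : ∀ c, ∀ φ ∈ P c, 0 ≤ hi c φ := fun c φ _ => mul_nonneg (Nat.cast_nonneg _) hε0
  -- the finite pair condition from the class check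
  have hcond : ∀ c c', c ≠ c' → ∀ φ ∈ P c, ∀ φ' ∈ P c',
      PairOK p (PhiOf D (col a) (col b) c c') (EOf D (col e) (col f) c c') φ φ'
        (lo c φ) (hi c φ) (lo c' φ') (hi c' φ') := by
    intro c c' hcc φ hφ φ' hφ'
    obtain ⟨h0, hplus, hminus⟩ := hpair c c' hcc φ hφ φ' hφ'
    have hS3 := hS c c' hcc
    rw [hD, phiOf_dbox, eOf_dbox]
    have hEabs : |lin t e f c c'| ≤ Sred t m n c c' * ε := abs_E_le t m n c c' e hsum ε hε
    -- `Φ mod 8` is the residue computation of the class check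
    have hΦ : ((lin t a b c c' : ℤ) : ZMod 8) =
        ClassData.PhiBar ⟨m, n, t, P, clo, chi⟩ (fun k => (a k : ZMod 8)) c c' := by
      change Int.castAddHom (ZMod 8) (lin t a b c c') = _
      rw [map_lin, ClassData.PhiBar]
      congr 1
      funext s
      simp only [Function.comp_apply, Int.coe_castAddHom, hγb]
    have hΦmod : (lin t a b c c' : ℤ) % 8 =
        ((ClassData.PhiBar ⟨m, n, t, P, clo, chi⟩ (fun k => (a k : ZMod 8)) c c').val : ℤ) := by
      rw [← hΦ, ZMod.val_intCast]
      rfl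
    set R : ℤ := ((ClassData.PhiBar ⟨m, n, t, P, clo, chi⟩ (fun k => (a k : ZMod 8)) c c').val : ℤ) with hR
    have hq : (8 : ℤ) * (lin t a b c c' / 8) + R = lin t a b c c' := by
      rw [← hΦmod]; linarith [Int.emod_add_mul_ediv (lin t a b c c') 8]
    set Φ : ℤ := lin t a b c c'
    set E : ℤ := lin t e f c c'
    set q : ℤ := Φ / 8
    refine ⟨?_, ?_, ?_, ?_⟩
    · have : Sred t m n c c' * ε ≤ 3 * ε := mul_le_mul_of_nonneg_right hS3 hε0
      have hEabs' : |E| ≤ 3 * ε := hEabs.trans this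
      have := abs_nonneg E
      linarith [hE]
    · intro h; apply h0; omega
    · intro h hEpos
      have h' : (φ - φ' - R - 1) % 8 = 0 := by omega
      rcases hplus h' with h1 | h1
      · left
        calc E ≤ |E| := le_abs_self E
          _ ≤ Sred t m n c c' * ε := hEabs
          _ ≤ (chi c' φ' : ℤ) * ε := mul_le_mul_of_nonneg_right h1 hε0
      · right
        calc E ≤ |E| := le_abs_self E
          _ ≤ Sred t m n c c' * ε := hEabs
          _ ≤ (clo c φ : ℤ) * ε := mul_le_mul_of_nonneg_right h1 hε0
    · intro h hEneg
      have h' : (φ - φ' - R + 1) % 8 = 0 := by omega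
      rcases hminus h' with h1 | h1
      · left
        calc -E ≤ |E| := neg_le_abs E
          _ ≤ Sred t m n c c' * ε := hEabs
          _ ≤ (clo c' φ' : ℤ) * ε := mul_le_mul_of_nonneg_right h1 hε0
      · right
        calc -E ≤ |E| := neg_le_abs E
          _ ≤ Sred t m n c c' * ε := hEabs
          _ ≤ (chi c φ : ℤ) * ε := mul_le_mul_of_nonneg_right h1 hε0
  -- independence of the arc set
  have indep : D.PatIndep u (arcSet p P lo hi) :=
    (patIndep_phaseCells D u (col a) (col e) (col b) (col f) hαD hβD P lo hi hlo hhi hcond).anti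
      (arcSet_subset_phaseCells hP hlo hhi)
  -- the count
  have big : 9 * p ≤ 5 * #(arcSet p P lo hi) := by
    have hc := card_arcSet_ge (p := p) ⟨m, n, t, P, clo, chi⟩ ε hε0 hP
    simp only [hlo_def, hhi_def]
    set N : ℕ := #(arcSet p P (fun c φ => (clo c φ : ℤ) * ε) (fun c φ => (chi c φ : ℤ) * ε))
    have hc' : ((ClassData.MIS ⟨m, n, t, P, clo, chi⟩ : ℕ) : ℤ) * (p - 15)
        - ((ClassData.SigT ⟨m, n, t, P, clo, chi⟩ : ℕ) : ℤ) * ε ≤ 8 * (N : ℤ) := hc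
    rcases henv with ⟨hM, hT⟩ | ⟨hM, hT⟩
    · rw [hM] at hc'
      have hT' : ((ClassData.SigT ⟨m, n, t, P, clo, chi⟩ : ℕ) : ℤ) * ε ≤ 24 * ε :=
        mul_le_mul_of_nonneg_right (by exact_mod_cast hT) hε0
      push_cast at hc'
      zify
      linarith [h16]
    · rw [hM] at hc'
      have hT' : ((ClassData.SigT ⟨m, n, t, P, clo, chi⟩ : ℕ) : ℤ) * ε ≤ 29 * ε :=
        mul_le_mul_of_nonneg_right (by exact_mod_cast hT) hε0
      push_cast at hc'
      zify
      linarith [h17]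
  -- nondegeneracy
  have hβ0 : β ≠ 0 := by
    intro hβ
    have hk : (m : ZMod p) + n * u = 0 := by
      rcases mul_eq_zero.1 hβ with h | h
      · exact h
      · exact absurd h hα
    have hN : ((m ^ 2 - m * n + n ^ 2 : ℤ) : ZMod p) = 0 := by
      push_cast
      linear_combination ((n : ZMod p) ^ 2) * hu + ((m : ZMod p) - n * u - n) * hk
    rw [ZMod.intCast_zmod_eq_zero_iff_dvd] at hN
    have := Int.le_of_dvd hN0 hN
    omega
  have hD' : D.Nondeg u := by
    refine D.nondeg_of u ?_ ?_
    · intro i i' h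
      simp only [hD, dbox, Prod.mk.injEq] at h
      obtain ⟨h1, h2⟩ := h
      fin_cases i <;> fin_cases i' <;> simp (decide := true) [hα, hα.symm] at h1 h2 ⊢
    · intro j j' h
      simp only [hD, dbox, Prod.mk.injEq] at h
      obtain ⟨h1, h2⟩ := h
      fin_cases j <;> fin_cases j' <;> simp (decide := true) [hβ0, hβ0.symm, ht, ht.symm] at h1 h2 ⊢
  exact D.not_boxUseful_of_pattern u hD' indep big

end PhaseArcs

end Summit.MatrixMultiplication.OmegaCensus
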